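/-
Copyright: literature formalisation for the harness. Statements follow the cited text.
-/
import Literature.AlgebraicGeometry.CossartPiltant200819.GaloisSegment2008
import Literature.AlgebraicGeometry.Resolution.SmoothUniformization
import Mathlib.FieldTheory.IsAlgClosed.AlgebraicClosure
import Mathlib.FieldTheory.IsSepClosed
import Mathlib.FieldTheory.Normal.Closure
import Mathlib.FieldTheory.IntermediateField.Adjoin.Algebra
import Mathlib.RingTheory.AlgebraicIndependent.TranscendenceBasis
import HarnessLib

/-!
# Cossart–Piltant I (2008), Thm 7.2 — the set-up of the tower and the final assembly

Sequel to `GaloisSegment2008`. The set-up of the proof of Thm 7.2 (HAL p. 20 l. 4–13 and p. 21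
l. 9–14): `K₀ := k(x₁, x₂, x₃)`, `K/K₀` finite (function field + transcendence basis), `K₁` the
separable closure of `K₀` in `K`, a finite Galois envelope `L'/K₀` of `K₁` with a valuation ring
`W̄` of `L'` extending `V ∩ K₁` (Chevalley), and the composition of the three segments

  `(K₀, V₀) → (K₀ⁱ, ·) → (K₀ʳ, ·) → (K₁ʳ, ·) → (K₁, V ∩ K₁)`  (Galois segment, `GaloisSegment2008`)
  `(K₁, V ∩ K₁) → … → (K, V)`                               (purely inseparable, `InseparableClimb2008`).

PROVED here (kernel-checked, no `sorry`):

* `finiteDimensional_adjoin_of_isTranscendenceBasis` — `K/k(x)` is finite for `K/k` finitely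
  generated and `x` a transcendence basis;
* `CReach3.of_isSeparable_of_tame` — for `K/F₀` finite and `K₁ ⊆ K` separable over `F₀`,
  `(F₀, O ∩ F₀)` reaches `(K₁, O ∩ K₁)` GIVEN the tame climb `TameSegmentClimb2008 k`: Galois
  envelope `normalClosure F₀ K₁ (separableClosure F₀ (AlgebraicClosure K₁))`, Chevalley extension
  (`Resolution.exists_valuationSubring_comap_eq`), `CReach3.galoisSegment_of_tame`, transport back
  along `K₁ ≃ image`;
* **`coarseTowerExists2008_of_tame : TameSegmentClimb2008 k → CoarseTowerExists2008 k`** and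
  **`galoisTowerExists2008_of_tame`**, `towerExists2008_of_tame` — the ONE named tower fact behind
  Thm 7.2 REDUCED to the tame climb `K₀ⁱ → K₀ʳ` (HAL (8); Zariski–Samuel VI §12 Thm 25);
* `reductionToArtinSchreier_of_tame`, `lu3DiffFinite_of_tame` — Thm 7.2 / `LU3DiffFinite` from
  Cor 6.3, Prop 8.3, Prop 9.5, the tame climb (and Prop 5.1, [CP-II]).

Not used (and not needed for the bookkeeping): rank one, `κ(V)/k` algebraic, `tr.deg = 3` — the
assembly holds for every finitely generated `K/k` and every transcendence basis.
[cite: CossartPiltant2008, Thm 7.2 proof (HAL p. 20 l. 4–13, p. 21 l. 9–14)]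
-/

namespace Literature.AlgebraicGeometry.CossartPiltant200819.CP2008

open Literature.AlgebraicGeometry.Resolution IsLocalRing IntermediateField
open scoped Pointwise IntermediateField

universe u

variable {k : Type u} [Field k]

/-- **`K/k(x)` is finite** for `K/k` finitely generated and `x` a transcendence basis (HAL p. 20
l. 4: "`K₀ := k(x₁,x₂,x₃)` … `K/K₀` is a finite extension"). [folklore] -/
theorem finiteDimensional_adjoin_of_isTranscendenceBasis {K : Type u} [Field K] [Algebra k K]
    (hfg : (⊤ : IntermediateField k K).FG) {ι : Type*} {x : ι → K}
    (hx : IsTranscendenceBasis k x) :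
    FiniteDimensional (IntermediateField.adjoin k (Set.range x)) K := by
  haveI : Algebra.EssFiniteType k K := IntermediateField.fg_top_iff.mp hfg
  haveI : Algebra.EssFiniteType (IntermediateField.adjoin k (Set.range x)) K :=
    Algebra.EssFiniteType.of_comp k (IntermediateField.adjoin k (Set.range x)) K
  haveI := hx.isAlgebraic_field
  exact Algebra.finite_of_essFiniteType_of_isAlgebraic
    (F := IntermediateField.adjoin k (Set.range x)) (E := K)

/-- **The Galois envelope and the Galois segment, assembled** (HAL p. 20 l. 25 – p. 21 l. 14):
for `K/F₀` finite, `K₁ ⊆ K` separable over `F₀` and `O` a valuation ring of `K` containing `k`,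
the stage `(F₀, O ∩ F₀)` reaches `(K₁, O ∩ K₁)` — GIVEN the tame climb. Construction: a finite
Galois `L'/F₀` containing a copy `M` of `K₁` (normal closure inside the separable closure of `F₀`
in an algebraic closure), `W̄` on `L'` with `W̄ ∩ K₁ = O ∩ K₁` (Chevalley), the Galois segment
`(F₀, W̄ ∩ F₀) → (M, W̄ ∩ M)`, and the `iso` move `M ≅ K₁`.
[cite: CossartPiltant2008, Thm 7.2 proof (HAL p. 20 l. 25 – p. 21 l. 14)] -/
theorem CReach3.of_isSeparable_of_tame (htame : TameSegmentClimb2008 k) (p : ℕ) (hp : p.Prime)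
    (hchar : CharP k p) {F0 K : Type u} [Field F0] [Algebra k F0] [Field K] [Algebra F0 K]
    [Algebra k K] [IsScalarTower k F0 K] [FiniteDimensional F0 K] (K₁ : IntermediateField F0 K)
    [Algebra.IsSeparable F0 K₁] (O : ValuationSubring K) (hk : ∀ c : k, algebraMap k K c ∈ O) :
    CReach3 k ⟨F0, O.comap (algebraMap F0 K), forall_algebraMap_mem_comap hk⟩
      ⟨K₁, O.comap (algebraMap K₁ K), forall_algebraMap_mem_comap_intermediateField hk K₁⟩ := by
  -- the envelope
  let Ω : Type u := AlgebraicClosure K₁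
  let E : IntermediateField F0 Ω := separableClosure F0 Ω
  let f₀ : K₁ →ₐ[F0] Ω := IsScalarTower.toAlgHom F0 K₁ Ω
  have hf₀ : ∀ y : K₁, f₀ y ∈ E := fun y =>
    mem_separableClosure_iff.mpr
      ((Algebra.IsSeparable.isSeparable F0 y).map f₀ f₀.toRingHom.injective)
  let f : K₁ →ₐ[F0] E := f₀.codRestrict E.toSubalgebra hf₀
  let L : IntermediateField F0 E := normalClosure F0 K₁ E
  have hfL : f.fieldRange ≤ L := AlgHom.fieldRange_le_normalClosure f
  let g : K₁ →ₐ[F0] L := f.codRestrict L.toSubalgebra fun y => hfL ⟨y, rfl⟩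
  let M : IntermediateField F0 L := g.fieldRange
  let g' : K₁ →ₐ[F0] M := g.codRestrict M.toSubalgebra fun y => ⟨y, rfl⟩
  have hg's : Function.Surjective g' := by
    rintro ⟨z, y, hy⟩
    exact ⟨y, Subtype.ext hy⟩
  let e₀ : K₁ ≃ₐ[F0] M := AlgEquiv.ofBijective g' ⟨g'.toRingHom.injective, hg's⟩
  let e : K₁ ≃ₐ[k] M := e₀.restrictScalars k
  haveI : IsGalois F0 L :=
    isGalois_iff.mpr ⟨Algebra.isSeparable_tower_bot_of_isSeparable F0 L E, inferInstance⟩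
  -- the valuation ring `W̄` on the envelope (Chevalley)
  obtain ⟨W, hW⟩ : ∃ W : ValuationSubring L,
      W.comap (g : K₁ →+* L) = O.comap (algebraMap K₁ K) := by
    letI : Algebra K₁ L := (g : K₁ →+* L).toAlgebra
    exact exists_valuationSubring_comap_eq _
  have hge : (algebraMap M L).comp (e : K₁ →+* M) = (g : K₁ →+* L) := RingHom.ext fun y => rfl
  have hg0 : (g : K₁ →+* L).comp (algebraMap F0 K₁) = algebraMap F0 L :=
    RingHom.ext fun c => g.commutes c
  have hstart : W.comap (algebraMap F0 L) = O.comap (algebraMap F0 K) := by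
    rw [← hg0, ← ValuationSubring.comap_comap, hW, ValuationSubring.comap_comap,
      ← IsScalarTower.algebraMap_eq F0 K₁ K]
  have hkW : ∀ c : k, algebraMap k L c ∈ W := fun c => by
    have h1 : algebraMap k F0 c ∈ W.comap (algebraMap F0 L) := by
      rw [hstart, ValuationSubring.mem_comap, ← IsScalarTower.algebraMap_apply]
      exact hk c
    rw [ValuationSubring.mem_comap, ← IsScalarTower.algebraMap_apply] at h1
    exact h1
  -- the Galois segment on the envelope
  have hseg := CReach3.galoisSegment_of_tame htame p hp hchar (K := F0) (L := L) W hkW M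
  -- back along `K₁ ≅ M`
  haveI : IsScalarTower k M L := isScalarTower_intermediateField' (k := k) M
  have hiso := CReach3.of_algEquiv_symm e (W.comap (algebraMap M L))
    (forall_algebraMap_mem_comap_intermediateField hkW M)
  have hcomp : (W.comap (algebraMap M L)).comap (e : K₁ →+* M) = O.comap (algebraMap K₁ K) := by
    rw [ValuationSubring.comap_comap, hge, hW]
  rw [VState.mk_congr hcomp _ (forall_algebraMap_mem_comap_intermediateField hk K₁)] at hiso
  rw [VState.mk_congr hstart _ (forall_algebraMap_mem_comap hk)] at hseg
  exact hseg.trans hiso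

/-- **The tower fact from the tame climb** — PROVED: `TameSegmentClimb2008 k` (the climb
`K₀ⁱ → K₀ʳ`, HAL (8)) implies `CoarseTowerExists2008 k` (hence `GaloisTowerExists2008 k`,
`BareTowerExists2008 k`, `TowerExists2008 k`). Assembly: `K₀ = k(x)`, `[K : K₀] < ∞`
(`finiteDimensional_adjoin_of_isTranscendenceBasis`), `K₁ = separableClosure K₀ K`,
`CReach3.of_isSeparable_of_tame` then `CReach3.separableClosure_top`. The hypotheses "rank one",
"`κ(V)/k` algebraic", "`tr.deg = 3`" of the fact are not used by the assembly.
[cite: CossartPiltant2008, Thm 7.2 proof (HAL pp. 20–21)] -/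
theorem coarseTowerExists2008_of_tame (htame : TameSegmentClimb2008 k) :
    CoarseTowerExists2008 k := by
  intro p hp hchar K _ _ hfg _htr O hk _hrk _hres x hx hsep
  haveI := finiteDimensional_adjoin_of_isTranscendenceBasis hfg hx
  haveI : IsScalarTower k (separableClosure (IntermediateField.adjoin k (Set.range x)) K) K :=
    isScalarTower_intermediateField' (k := k) _
  have h1 := CReach3.of_isSeparable_of_tame htame p hp hchar
    (F0 := IntermediateField.adjoin k (Set.range x)) (K := K)
    (separableClosure (IntermediateField.adjoin k (Set.range x)) K) O hk
  have h2 := CReach3.separableClosure_top p hp hchar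
    (K₀ := IntermediateField.adjoin k (Set.range x)) (K := K) hsep O hk
  exact h1.trans h2

/-- **`GaloisTowerExists2008` from the tame climb** — PROVED.
[cite: CossartPiltant2008, Thm 7.2 proof (HAL pp. 20–21)] -/
theorem galoisTowerExists2008_of_tame (htame : TameSegmentClimb2008 k) :
    GaloisTowerExists2008 k :=
  coarseTowerExists2008_iff.mp (coarseTowerExists2008_of_tame htame)

/-- **`TowerExists2008` from the tame climb** — PROVED.
[cite: CossartPiltant2008, Thm 7.2 proof (HAL pp. 20–21)] -/
theorem towerExists2008_of_tame (htame : TameSegmentClimb2008 k) : TowerExists2008 k :=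
  towerExists2008_of_coarseTower (coarseTowerExists2008_of_tame htame)

/-- **Theorem 7.2 from its leaves, with the tame climb** — PROVED: Cor 6.3, Prop 8.3, Prop 9.5
and the tame climb `K₀ⁱ → K₀ʳ` imply `ReductionToArtinSchreier`.
[cite: CossartPiltant2008, Thm 7.2 (HAL pp. 19–21)] -/
theorem reductionToArtinSchreier_of_tame (h63 : ClimbToInertiaField.{u})
    (h83 : PrimeDegreeAscent.{u}) (h95 : DescentBelowRamificationField.{u})
    (hT : ∀ (k : Type u) [Field k], TameSegmentClimb2008 k) : ReductionToArtinSchreier.{u} :=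
  reductionToArtinSchreier_of_coarseTower h63 h83 h95
    fun k _ => coarseTowerExists2008_of_tame (hT k)

/-- **`LU3DiffFinite` from its leaves, with the tame climb** — PROVED: Prop 5.1, Cor 6.3,
Prop 8.3, Prop 9.5, the tame climb and [CP-II] imply `LU3DiffFinite`.
[cite: CossartPiltant2008, Thm 7.2 + Section 2 (HAL pp. 3–4, 19–21)] -/
theorem lu3DiffFinite_of_tame (p51 : RankReduction.{u}) (h63 : ClimbToInertiaField.{u})
    (h83 : PrimeDegreeAscent.{u}) (h95 : DescentBelowRamificationField.{u})
    (hT : ∀ (k : Type u) [Field k], TameSegmentClimb2008 k) (cp2 : CossartPiltant2009Main.{u}) :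
    LU3DiffFinite.{u} :=
  lu3DiffFinite_of_coarseTower p51 h63 h83 h95 (fun k _ => coarseTowerExists2008_of_tame (hT k)) cp2

end Literature.AlgebraicGeometry.CossartPiltant200819.CP2008
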